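import Mathlib
import Literature.AlgebraicGeometry.Resolution.WeightedResolutionDatum
import Summits.ResolutionOfSingularities.ResolutionOfSingularities.Theorems.WeightedInvariantHypersurfaceLocalGameEFT4S

/-!
# The P2 RUNG STATEMENT of the key `LocalWeightedDropEFT4S` — its ten clauses with every regular-local-ring binder of the
# three position-dependent clauses restricted to Krull dimension ≤ 2 (door `HypersurfaceCentreConstruction`,
# stmt-ResolutionOfSingularities-19897, line `local-engine`, CRUX-PLAN §v7.2 / §v8.4, ORDER (o24))

Statement module of record for ORDER (o24) of the door registrar res-L1-w43-plan-1 (RULING gen 9 #4, HOME/STATUS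
2026-08-27T07:58:51Z, and ORDER (o24-S) 08:04:10Z): the registrar's sketch `L/res-L1-w43-plan-1/p2_rung_statement_v1.lean`
(sha16 `4f9fbd64f7831a81`, farm rc 0 · 0 sorries) filed VERBATIM as a tree module by res-type-073 (typer; namespace suffix
`.P2Sketch` dropped, docstrings tagged; nothing else changed). Definitions only plus two sorry-free seams; NO mathematics.

[OURS · candidates · conjecture-grade design objects; nothing here asserts anything about Hironaka's problem; NOT a statement of
the manuscript under review (Hironaka 2017, [claim: Hironaka2017, status: under-review]); AI planning, weaker than expert
review.]

## What this module types

The (o24) rung of the KEY `stub_localWeightedDropEFT4S`: every clause of `LocalWeightedDropEFT4S p`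
(`Theorems/WeightedInvariantHypersurfaceLocalGameEFT4S.lean`, p504475) for ONE pair `(ι, J)` with EVERY regular-local-ring
binder restricted to Krull dimension ≤ 2 — positions `S` of (c9′), targets `S'` of (c11), the model primes `𝔪` and `𝔮` of
(open″). Dimension ≥ 3 is the open regime P3 and is not claimed. The clause bodies below are VERBATIM copies of
`IotaJEssSmoothCompatible`, `CanonicalGameClause`, `JOpenPresentationForallSing` with the added `ringKrullDim … ≤ 2`
hypotheses and nothing else:

* `IotaJEssSmoothCompatibleLE2 ι J` — (c11)↾≤2;
* `CanonicalGameClauseLE2 p ι J` — (c9′)↾≤2 (subsumes the P1 rung (o23) = Krull dimension 1 and the dim-2 game (o24-G));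
* `JOpenPresentationForallSingLE2 p ι J` — (open″)↾≤2 (model prime `𝔪` with `ringKrullDim A_𝔪 ≤ 2`; demands only at
  `𝔮 ∈ D(h)` with `ringKrullDim A_𝔮 ≤ 2`);
* `P2Rung p ι J` — the conjunction of the ten clauses with these three restricted; ORDER (o24) TARGET OF RECORD:
  `∀ p, p.Prime → P2Rung p iotaOrd jContact` (`iotaOrd`: p502169; `jContact`: ORDER (o24-D));
* seams `p2Rung_of_clauses` (unrestricted clauses ⇒ rung) and `p2Rung_of_eft4S_witness` (a witness of the key is a
  witness of the rung), both proved.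

Assembly plan of record (registrar, ORDER (o24-S)): (c6)(c7)(c8)(c10)(c12a-ι) for `iotaOrd` = res-type-073's files in the
tree; `JIsoInvariant`/`JUnitInvariant` = (o24-D); (c11)↾≤2 = (o24-C); (c9′)↾≤2 = P1 (res-type-005) ∧ (o24-G) (res-type-098);
(open″)↾≤2 = P1 (p511512 + (o23c)) ∧ (o24-O). Every (o24-·) theorem is to be stated LITERALLY as the corresponding conjunct
of `P2Rung p iotaOrd jContact` so that the rung assembles by `exact ⟨…⟩`.
-/

set_option linter.dupNamespace false

noncomputable section

open IsLocalRing Literature.AlgebraicGeometry.Resolution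

namespace Summit.ResolutionOfSingularities.ResolutionOfSingularities.Cruxes.HypersurfaceCentreConstruction.LocalEngine

/-- (c11)↾≤2: `IotaJEssSmoothCompatible` with the TARGET `S'` of Krull dimension ≤ 2 (hence relative dimension 0 or
`S` a DVR/field). Body verbatim otherwise. [OURS · candidate clause of the P2 rung · registrar res-L1-w43-plan-1] -/
def IotaJEssSmoothCompatibleLE2 (ι : (R : Type) → [CommRing R] → R → Ordinal.{0})
    (J : (R : Type) → [CommRing R] → R → ℕ → Ideal R) : Prop :=
  ∀ (S S' : Type) [CommRing S] [IsRegularLocalRing S] [CommRing S'] [IsRegularLocalRing S'] [Algebra S S']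
    [IsLocalHom (algebraMap S S')] [Algebra.FormallySmooth S S'] [Algebra.EssFiniteType S S'] (f : S),
    ringKrullDim S' ≤ 2 →
    ι S' (algebraMap S S' f) = ι S f ∧ ∀ m : ℕ, J S' (algebraMap S S' f) m = (J S f m).map (algebraMap S S')

/-- (c9′)↾≤2: `CanonicalGameClause` at positions `S` of Krull dimension ≤ 2 (dimension 1 = the P1 rung (o23),
dimension 0 is vacuous). Body verbatim. [OURS · candidate clause of the P2 rung · registrar res-L1-w43-plan-1] -/
def CanonicalGameClauseLE2 (p : ℕ) (ι : (R : Type) → [CommRing R] → R → Ordinal.{0})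
    (J : (R : Type) → [CommRing R] → R → ℕ → Ideal R) : Prop :=
  ∀ (k₀ : Type) [Field k₀] [CharP k₀ p] [PerfectField k₀]
    (S : Type) [CommRing S] [Algebra k₀ S] [Algebra.EssFiniteType k₀ S] [IsRegularLocalRing S]
    (f : S), ringKrullDim S ≤ 2 → f ≠ 0 → f ∈ (maximalIdeal S) ^ 2 →
    ∃ (P : Ideal S), P.IsPrime ∧ IsRegularLocalRing (S ⧸ P) ∧ f ∈ P ∧
      (∀ (𝔭 : Ideal S) [𝔭.IsPrime], f ∈ 𝔭 →
        (ι (Localization.AtPrime 𝔭) (algebraMap S (Localization.AtPrime 𝔭) f) = ι S f ↔ P ≤ 𝔭)) ∧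
      (∀ (𝔭 : Ideal S) [𝔭.IsPrime], f ∈ 𝔭 → P ≤ 𝔭 → ∀ m : ℕ,
        J (Localization.AtPrime 𝔭) (algebraMap S (Localization.AtPrime 𝔭) f) m =
          (J S f m).map (algebraMap S (Localization.AtPrime 𝔭))) ∧
      ∃ (n : ℕ) (u : Fin n → S) (w : Fin n → ℕ),
        Ideal.span (Set.range u) = maximalIdeal S ∧ (maximalIdeal S).spanFinrank = n ∧ (∃ i, 0 < w i) ∧
        Ideal.span {x | ∃ i, 0 < w i ∧ x = u i} = P ∧
        (∀ m : ℕ, weightedMonomialIdeal u w m = J S f m) ∧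
        (∀ (Q : Ideal S) [Q.IsPrime], P ≤ Q →
          algebraMap S (Localization.AtPrime Q) f ∈ (maximalIdeal (Localization.AtPrime Q)) ^ 2) ∧
        ∀ (𝔫 : Ideal (cobordantAlgebra' u w)) [𝔫.IsPrime],
          cobordantT' u w ∈ 𝔫 →
          P.map (algebraMap S (cobordantAlgebra' u w)) ≤ 𝔫 →
          ¬ (extReesAlgebra.vertexIdeal (weightedMonomialIdeal u w) ≤ 𝔫) →
          ∀ (a : ℕ) (g : cobordantAlgebra' u w),
            algebraMap S (cobordantAlgebra' u w) f = cobordantT' u w ^ a * g →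
            ¬ (cobordantT' u w ∣ g) →
            algebraMap (cobordantAlgebra' u w) (Localization.AtPrime 𝔫) g ∈
              (maximalIdeal (Localization.AtPrime 𝔫)) ^ 2 →
            ι (Localization.AtPrime 𝔫) (algebraMap (cobordantAlgebra' u w) (Localization.AtPrime 𝔫) g) < ι S f

/-- (open″)↾≤2: `JOpenPresentationForallSing` for model primes `𝔪` with `A_𝔪` of Krull dimension ≤ 2, the stratum /
presentation demands being made only at primes `𝔮 ∈ D(h)` with `A_𝔮` of Krull dimension ≤ 2. Body verbatim otherwise.
[OURS · candidate clause of the P2 rung · registrar res-L1-w43-plan-1] -/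
def JOpenPresentationForallSingLE2 (p : ℕ) (ι : (R : Type) → [CommRing R] → R → Ordinal.{0})
    (J : (R : Type) → [CommRing R] → R → ℕ → Ideal R) : Prop :=
  ∀ (k₀ : Type) [Field k₀] [CharP k₀ p] [PerfectField k₀]
    (A : Type) [CommRing A] [Algebra k₀ A] [Algebra.FiniteType k₀ A] (𝔪 : Ideal A) [𝔪.IsPrime] (F : A),
    IsRegularLocalRing (Localization.AtPrime 𝔪) →
    ringKrullDim (Localization.AtPrime 𝔪) ≤ 2 →
    algebraMap A (Localization.AtPrime 𝔪) F ≠ 0 →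
    algebraMap A (Localization.AtPrime 𝔪) F ∈ (maximalIdeal (Localization.AtPrime 𝔪)) ^ 2 →
    ∃ h : A, h ∉ 𝔪 ∧ ∃ (N : ℕ) (U : Fin N → A) (W : Fin N → ℕ), (∀ i, 0 < W i) ∧
      (∃ hU : ∀ i, algebraMap A (Localization.AtPrime 𝔪) (U i) ∈ maximalIdeal (Localization.AtPrime 𝔪),
        LinearIndependent (ResidueField (Localization.AtPrime 𝔪))
          (fun i => ((maximalIdeal (Localization.AtPrime 𝔪)).toCotangent ⟨_, hU i⟩ :
            CotangentSpace (Localization.AtPrime 𝔪)))) ∧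
      ∀ (𝔮 : Ideal A) [𝔮.IsPrime], h ∉ 𝔮 → ringKrullDim (Localization.AtPrime 𝔮) ≤ 2 →
        ((∀ i, U i ∈ 𝔮) ↔
          (algebraMap A (Localization.AtPrime 𝔮) F ∈ (maximalIdeal (Localization.AtPrime 𝔮)) ^ 2 ∧
            ι (Localization.AtPrime 𝔮) (algebraMap A (Localization.AtPrime 𝔮) F) =
              ι (Localization.AtPrime 𝔪) (algebraMap A (Localization.AtPrime 𝔪) F))) ∧
        ((∀ i, U i ∈ 𝔮) → ∀ m : ℕ,
          J (Localization.AtPrime 𝔮) (algebraMap A (Localization.AtPrime 𝔮) F) m =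
            (weightedMonomialIdeal U W m).map (algebraMap A (Localization.AtPrime 𝔮)))

/-- THE P2 RUNG for a pair `(ι, J)`: the ten clauses of `LocalWeightedDropEFT4S p` with the three position-dependent
clauses restricted to Krull dimension ≤ 2.  ORDER (o24) target: `P2Rung p iotaOrd jContact` for every prime `p`
(`jContact` = ORDER (o24-D)'s centre filtration). A BC5-type rung of the key (CRUX-PLAN §v7.2/§v8.4), not a claim about the
key itself; dimension ≥ 3 is the open regime. [OURS · candidate · registrar res-L1-w43-plan-1] -/
def P2Rung (p : ℕ) (ι : (R : Type) → [CommRing R] → R → Ordinal.{0})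
    (J : (R : Type) → [CommRing R] → R → ℕ → Ideal R) : Prop :=
  IotaIsoInvariant ι ∧ IotaGenerizationMonotone ι ∧ IotaUpperSemicontinuous ι ∧ IotaTorusFactorMonotone ι ∧
  JIsoInvariant J ∧ IotaJEssSmoothCompatibleLE2 ι J ∧ CanonicalGameClauseLE2 p ι J ∧
  JOpenPresentationForallSingLE2 p ι J ∧ IotaUnitInvariant ι ∧ JUnitInvariant J

/-- Sanity seam (sorry-free): the unrestricted clauses give the rung (so the KEY implies every P2 rung). -/
theorem p2Rung_of_clauses (p : ℕ) (ι : (R : Type) → [CommRing R] → R → Ordinal.{0})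
    (J : (R : Type) → [CommRing R] → R → ℕ → Ideal R)
    (h1 : IotaIsoInvariant ι) (h2 : IotaGenerizationMonotone ι) (h3 : IotaUpperSemicontinuous ι)
    (h4 : IotaTorusFactorMonotone ι) (h5 : JIsoInvariant J) (h6 : IotaJEssSmoothCompatible ι J)
    (h7 : CanonicalGameClause p ι J) (h8 : JOpenPresentationForallSing p ι J) (h9 : IotaUnitInvariant ι)
    (h10 : JUnitInvariant J) : P2Rung p ι J := by
  refine ⟨h1, h2, h3, h4, h5, ?_, ?_, ?_, h9, h10⟩
  · intro S S' _ _ _ _ _ _ _ _ f _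
    exact h6 S S' f
  · intro k₀ _ _ _ S _ _ _ _ f _ hf0 hf2
    exact h7 k₀ S f hf0 hf2
  · intro k₀ _ _ _ A _ _ _ 𝔪 _ F hreg _ hF0 hF2
    obtain ⟨h, hh, N, U, W, hW, hU, hq⟩ := h8 k₀ A 𝔪 F hreg hF0 hF2
    exact ⟨h, hh, N, U, W, hW, hU, fun 𝔮 _ hq𝔮 _ => hq 𝔮 hq𝔮⟩

/-- Sanity seam: a witness of the KEY `LocalWeightedDropEFT4S p` is a witness of the P2 rung. -/
theorem p2Rung_of_eft4S_witness (p : ℕ) (h : LocalWeightedDropEFT4S p) :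
    ∃ ι J, P2Rung p ι J := by
  obtain ⟨ι, J, h1, h2, h3, h4, h5, h6, h7, h8, h9, h10⟩ := h
  exact ⟨ι, J, p2Rung_of_clauses p ι J h1 h2 h3 h4 h5 h6 h7 h8 h9 h10⟩

end Summit.ResolutionOfSingularities.ResolutionOfSingularities.Cruxes.HypersurfaceCentreConstruction.LocalEngine

end
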